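import Literature.NumberTheory.LFunctions.Zhang2022.Section8Lemma82
import HarnessLib

/-!
# Zhang (2022) §8: the (A)-world DIPOLE RULE for superposed weights — Lemma 8.2 at `δ = 0` (the Riesz mean
# `Σ_{m≤x} χ(m)m⁻¹log(x/m) = L′(1,χ) + O(𝓛⁻⁶)` on `[T,P]`) integrated against a weight
# `V(z) = Σ_i c_i(ζ_i − z)₊ + ∫₀^Z (y − z)₊σ(y)dy`: `Σ_m χ(m)m⁻¹V(z_m) = −L′(1,χ)·V′(0⁺)/log P + o(L′/log P)`

Topic `Literature/NumberTheory/LFunctions/Zhang2022` (Landau–Siegel audit tree; verdict-neutral). Y. Zhang, *Discrete mean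
estimates and the Landau–Siegel zero*, arXiv:2211.02515v1 (2022) [Zhang2022LandauSiegel] — **an unrefereed manuscript
under adjudication; nothing here asserts or denies its Theorems 1–2, and nothing here is a claim about Landau–Siegel
zeros.** Cell landau-siegel §D, CHAIN #1 (toeplitz closure squad), crux K0 = stmt-Parity-20459 `InClassSideTablesPiece`
(the repaired side table), prover ls-knife-K0-p1 g0: this is the ψ-SIDE ENGINE («LEMMA A» of K1″a DISPLAY #2 / #5) for
GENERAL in-class profiles, obtained from the tree's Lemma 8.2 (`Lemma82.sum_twist_log_sub_main_le`, kernel-checked) by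
SUPERPOSITION instead of a new contour argument.

## The mechanism

Lemma 8.2 with both shifts equal (`δ = β_μ − β_j = 0`, allowed by the tree's general form with `K = 0`) is the statement
that the RIESZ MEAN of `χ(m)/m` is locally constant under (A):

  (R)  `R_χ(x) := Σ_{m≤x} χ(m)m⁻¹log(x/m) = L′(1,χ) + O(𝓛⁻⁶)`  uniformly for `T = e^{𝓛^{1.1}} ≤ x ≤ P = e^{𝓛⁹}`

(`rieszMean_sub_deriv_le`); below `T` only the trivial bound `|R_χ(x)| ≤ log x·(1 + log x)` is used
(`norm_rieszMean_le`). A weight in the logarithmic variable `z = log m/log P` of the form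

  `V(z) = Σ_i c_i·(ζ_i − z)₊ + ∫₀^Z (y − z)₊ σ(y) dy`   (finitely many RAMP ATOMS at heights `ζ_i`, an L¹ density `σ`)

— every continuous piecewise-`C²` profile vanishing from `Z` on is of this form (atoms = kinks, `σ = V″` on the smooth
pieces; that Taylor bookkeeping is the CALLER's) — satisfies `Σ_{m≤P^Z} χ(m)m⁻¹(ζ − z_m)₊ = R_χ(P^ζ)/log P` termwise
(`sum_ramp_eq_rieszMean`), hence

  `Σ_{m ≤ P^Z} χ(m)m⁻¹V(z_m) = (log P)⁻¹·[Σ_i c_i R_χ(P^{ζ_i}) + ∫₀^Z σ(y)R_χ(P^y)dy]`   (exact; `sum_superposed_eq`),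

and (R) turns the bracket into `L′(1,χ)·(Σ_i c_i + ∫₀^Z σ) + error` — the JET `J := Σ_i c_i + ∫σ = −V′(0⁺)`:

  **`dipole_superposed`**: `‖Σ_{m≤P^Z} χ(m)m⁻¹V(z_m) − (log P)⁻¹L′(1,χ)J‖ ≤`
  `(log P)⁻¹·[C₈₂(0)𝓛⁻⁶·(Σ_i‖c_i‖ + ∫₀^Z‖σ‖) + τ·S·(2𝓛^{2.2} + ‖L′(1,χ)‖)]`,  `τ = 𝓛^{1.1}/𝓛⁹`,

for atoms with `τ ≤ ζ_i ≤ Z ≤ 1` (i.e. `T ≤ P^{ζ_i} ≤ P`) and `‖σ‖ ≤ S` on `[0, τ]` (the low range, where (R) is replaced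
by the trivial bound). With `‖L′(1,χ)‖ ≪ 𝓛²` this is `O(𝓛⁻¹⁵)·(Σ‖c_i‖ + ‖σ‖₁) + O(S·𝓛^{−14.7})` against the main term
`≍ L′/log P ≍ L′𝓛⁻⁹` — DISPLAY #2's «LEMMA A with remainder O(C(w)𝓛⁻¹⁵)», now a kernel theorem for superposed weights.
The ψ-side inner sum of Prop 7.1's `S_j` for profile data, `Σ_m χ(m)m^{β_j−1}u(z_t + z_m)`, is the case
`V(z) = e^{(β_j log P)z}u(z_t + z)` (caller's Taylor data), giving `−(L′/log P)(u′(z_t) + β_j log P·u(z_t))` = the jet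
`𝔧_j(u; z_t)` of `KnifeEdge.k0jet` up to `β_j log P = iπb_j(1 + O(α𝓛))`.

## Contents
* `rieszMean`, `rieszMean_eq_sum_twist`, `rieszMean_sub_deriv_le` ((R), from `Lemma82.sum_twist_log_sub_main_le` at
  `δ = 0`, `K = 0`), `norm_rieszMean_le` (trivial bound via `harmonic_le_one_add_log`);
* `ramp`, `sum_ramp_eq_rieszMean` (one atom), `superposedWeight`, `superposedJet`, `sum_superposed_eq` (exact
  superposition identity), `dipole_superposed` (the estimate at a fixed modulus under (A)).

## References
* Y. Zhang, arXiv:2211.02515v1 (2022), §8 Lemma 8.2, pp. 16–17; §2 (2.6), (2.10). [cite: Zhang2022LandauSiegel, §8 Lemma 8.2]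
-/

noncomputable section

open Complex Real Finset MeasureTheory intervalIntegral Set

namespace Literature.NumberTheory.LFunctions.Zhang2022.DipoleRule

variable {D : ℕ} [NeZero D] (χ : DirichletCharacter ℂ D)

/-! ### The Riesz mean of `χ(m)/m` -/

/-- **The Riesz mean `R_χ(x) = Σ_{m≤x} χ(m)·m⁻¹·log(x/m)`** (the sum of Lemma 8.2 with both shifts equal).
[cite: Zhang2022LandauSiegel, §8 Lemma 8.2] -/
def rieszMean (x : ℝ) : ℂ :=
  ∑ m ∈ Finset.Ioc 0 ⌊x⌋₊, χ (m : ZMod D) * (m : ℂ)⁻¹ * (Real.log (x / m) : ℂ)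

omit [NeZero D] in
/-- `R_χ(x)` is the sum of `Lemma82.sum_twist_log_sub_main_le` at `δ = 0`. [cite: Zhang2022LandauSiegel, §8 Lemma 8.2] -/
theorem rieszMean_eq_sum_twist (x : ℝ) :
    rieszMean χ x = ∑ m ∈ Finset.Ioc 0 ⌊x⌋₊, Lemma82.twist χ 0 m * (Real.log (x / m) : ℂ) := by
  unfold rieszMean Lemma82.twist
  refine Finset.sum_congr rfl fun m _ => ?_
  rw [sub_zero, Complex.cpow_neg_one]

/-- **(R) — Lemma 8.2 at `δ = 0`:** for `χ` primitive, `log D ≥ 3`, (A) `‖L(1,χ)‖ ≤ 𝓛⁻²⁰²²`, and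
`T = e^{𝓛^{1.1}} ≤ x ≤ P = e^{𝓛⁹}`: `‖R_χ(x) − L′(1,χ)‖ ≤ C₈₂(0)·𝓛⁻⁶`. [cite: Zhang2022LandauSiegel, §8 Lemma 8.2] -/
theorem rieszMean_sub_deriv_le (hprim : χ.IsPrimitive) (hL : 3 ≤ Real.log D)
    (hA : ‖χ.LFunction 1‖ ≤ 1 / Real.log D ^ 2022) {x : ℝ} (hxT : Real.exp (Real.log D ^ (11 / 10 : ℝ)) ≤ x)
    (hxP : x ≤ Real.exp (Real.log D ^ 9)) :
    ‖rieszMean χ x - deriv χ.LFunction 1‖ ≤ Lemma82.C82 0 / Real.log D ^ 6 := by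
  have hK : 4 * (0 : ℝ) * π ≤ Real.log D ^ 8 := by
    have : 0 ≤ Real.log D := by linarith
    simp only [mul_zero, zero_mul]; positivity
  have h := Lemma82.sum_twist_log_sub_main_le χ hprim hL hA (K := 0) le_rfl hK (δ := 0) (by simp)
    (by simp) hxT hxP
  simpa only [rieszMean_eq_sum_twist, zero_mul, add_zero, mul_one] using h

omit [NeZero D] in
/-- **Trivial bound:** `‖R_χ(x)‖ ≤ log x·(1 + log x)` for `x ≥ 1` (`|χ| ≤ 1`, `0 ≤ log(x/m) ≤ log x`,
`Σ_{m≤x} 1/m ≤ 1 + log x`) — the bound used below `T`, where Lemma 8.2 is silent. [cite: Zhang2022LandauSiegel, §8 Lemma 8.2] -/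
theorem norm_rieszMean_le {x : ℝ} (hx : 1 ≤ x) : ‖rieszMean χ x‖ ≤ Real.log x * (1 + Real.log x) := by
  have hx0 : 0 < x := by linarith
  have hlogx : 0 ≤ Real.log x := Real.log_nonneg hx
  unfold rieszMean
  -- termwise bound `‖χ(m) m⁻¹ log(x/m)‖ ≤ log x · m⁻¹`
  have hterm : ∀ m ∈ Finset.Ioc 0 ⌊x⌋₊,
      ‖χ (m : ZMod D) * (m : ℂ)⁻¹ * (Real.log (x / m) : ℂ)‖ ≤ Real.log x * (m : ℝ)⁻¹ := by
    intro m hm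
    rw [Finset.mem_Ioc] at hm
    have hm1 : (1 : ℝ) ≤ m := by exact_mod_cast hm.1
    have hm0 : (0 : ℝ) < m := by linarith
    have hmx : (m : ℝ) ≤ x := le_trans (by exact_mod_cast hm.2) (Nat.floor_le hx0.le)
    have hlog0 : 0 ≤ Real.log (x / m) := Real.log_nonneg ((one_le_div hm0).mpr hmx)
    have hlogle : Real.log (x / m) ≤ Real.log x := by
      rw [Real.log_div hx0.ne' hm0.ne']
      linarith [Real.log_nonneg hm1]
    rw [norm_mul, norm_mul, Complex.norm_real, Real.norm_eq_abs, abs_of_nonneg hlog0, norm_inv,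
      Complex.norm_natCast]
    calc ‖χ (m : ZMod D)‖ * (m : ℝ)⁻¹ * Real.log (x / m) ≤ 1 * (m : ℝ)⁻¹ * Real.log x := by
          gcongr
          exact χ.norm_le_one _
      _ = Real.log x * (m : ℝ)⁻¹ := by ring
  -- harmonic sum
  have hharm : ∑ m ∈ Finset.Ioc 0 ⌊x⌋₊, (m : ℝ)⁻¹ ≤ 1 + Real.log x := by
    have h1 := harmonic_le_one_add_log ⌊x⌋₊
    rw [harmonic_eq_sum_Icc] at h1
    push_cast at h1
    have hIcc : Finset.Ioc 0 ⌊x⌋₊ = Finset.Icc 1 ⌊x⌋₊ := by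
      ext m; simp only [Finset.mem_Ioc, Finset.mem_Icc]; omega
    rw [hIcc]
    refine h1.trans ?_
    rcases Nat.eq_zero_or_pos ⌊x⌋₊ with h0 | hpos
    · rw [h0]; simp [hlogx]
    · have : Real.log (⌊x⌋₊ : ℝ) ≤ Real.log x :=
        Real.log_le_log (by exact_mod_cast hpos) (Nat.floor_le hx0.le)
      linarith
  calc ‖∑ m ∈ Finset.Ioc 0 ⌊x⌋₊, χ (m : ZMod D) * (m : ℂ)⁻¹ * (Real.log (x / m) : ℂ)‖
      ≤ ∑ m ∈ Finset.Ioc 0 ⌊x⌋₊, ‖χ (m : ZMod D) * (m : ℂ)⁻¹ * (Real.log (x / m) : ℂ)‖ := norm_sum_le _ _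
    _ ≤ ∑ m ∈ Finset.Ioc 0 ⌊x⌋₊, Real.log x * (m : ℝ)⁻¹ := Finset.sum_le_sum hterm
    _ = Real.log x * ∑ m ∈ Finset.Ioc 0 ⌊x⌋₊, (m : ℝ)⁻¹ := by rw [Finset.mul_sum]
    _ ≤ Real.log x * (1 + Real.log x) := mul_le_mul_of_nonneg_left hharm hlogx

/-! ### Ramp atoms and the superposition identity -/

/-- **The ramp atom `(ζ − z)₊`** — one kink at height `ζ`; in the variable `z = log m/Λ` it is the Riesz kernel
`log(e^{ζΛ}/m)₊/Λ`. [cite: Zhang2022LandauSiegel, §8 Lemma 8.2] -/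
def ramp (ζ z : ℝ) : ℝ := max (ζ - z) 0

/-- `ramp` is continuous in the kink height (plumbing for the superposition integral). [cite: Zhang2022LandauSiegel, §8 Lemma 8.2] -/
theorem continuous_ramp_left (z : ℝ) : Continuous fun ζ => ramp ζ z := by
  unfold ramp
  exact (continuous_id.sub continuous_const).max continuous_const

omit [NeZero D] in
/-- **One atom is one Riesz mean:** for `Λ > 0` and `⌊e^{ζΛ}⌋ ≤ N`,
`Σ_{m≤N} χ(m)m⁻¹(ζ − log m/Λ)₊ = Λ⁻¹·R_χ(e^{ζΛ})` (terms `m > e^{ζΛ}` vanish). [cite: Zhang2022LandauSiegel, §8 Lemma 8.2] -/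
theorem sum_ramp_eq_rieszMean {Λ ζ : ℝ} (hΛ : 0 < Λ) {N : ℕ} (hN : ⌊Real.exp (ζ * Λ)⌋₊ ≤ N) :
    ∑ m ∈ Finset.Ioc 0 N, χ (m : ZMod D) * (m : ℂ)⁻¹ * (ramp ζ (Real.log m / Λ) : ℂ)
      = (Λ : ℂ)⁻¹ * rieszMean χ (Real.exp (ζ * Λ)) := by
  set x : ℝ := Real.exp (ζ * Λ) with hx
  have hx0 : 0 < x := Real.exp_pos _
  have hΛ0 : (Λ : ℂ) ≠ 0 := by exact_mod_cast hΛ.ne'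
  -- split `Ioc 0 N = Ioc 0 ⌊x⌋ ∪ Ioc ⌊x⌋ N`
  rw [← Finset.sum_Ioc_consecutive _ (Nat.zero_le _) hN]
  have htail : ∑ m ∈ Finset.Ioc ⌊x⌋₊ N, χ (m : ZMod D) * (m : ℂ)⁻¹ * (ramp ζ (Real.log m / Λ) : ℂ) = 0 := by
    refine Finset.sum_eq_zero fun m hm => ?_
    rw [Finset.mem_Ioc] at hm
    have hmx : x < m := Nat.lt_of_floor_lt hm.1
    have hm0 : (0 : ℝ) < m := lt_trans hx0 hmx
    have hlog : ζ * Λ < Real.log m := by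
      rw [← Real.log_exp (ζ * Λ)]
      exact Real.log_lt_log hx0 hmx
    have hr : ramp ζ (Real.log m / Λ) = 0 := by
      unfold ramp
      apply max_eq_right
      rw [sub_nonpos, le_div_iff₀ hΛ]
      exact hlog.le
    rw [hr]; simp
  rw [htail, add_zero]
  unfold rieszMean
  rw [Finset.mul_sum]
  refine Finset.sum_congr rfl fun m hm => ?_
  rw [Finset.mem_Ioc] at hm
  have hm0 : (0 : ℝ) < m := by exact_mod_cast hm.1
  have hmx : (m : ℝ) ≤ x := le_trans (by exact_mod_cast hm.2) (Nat.floor_le hx0.le)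
  have hlog : Real.log m ≤ ζ * Λ := by
    rw [← Real.log_exp (ζ * Λ)]
    exact Real.log_le_log hm0 hmx
  have hr : ramp ζ (Real.log m / Λ) = Real.log (x / m) / Λ := by
    unfold ramp
    rw [max_eq_left (by rw [sub_nonneg, div_le_iff₀ hΛ]; exact hlog), Real.log_div hx0.ne' hm0.ne', hx,
      Real.log_exp]
    field_simp
  rw [hr]
  push_cast
  field_simp

/-- **A superposed weight**: finitely many ramp atoms of complex weights `c_i` at heights `ζ_i`, plus an L¹ density `σ`
of ramps on `[0, Z]`: `V(z) = Σ_i c_i(ζ_i − z)₊ + ∫₀^Z (y − z)₊σ(y)dy`. [cite: Zhang2022LandauSiegel, §8 Lemma 8.2] -/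
def superposedWeight {n : ℕ} (c : Fin n → ℂ) (ζ : Fin n → ℝ) (Z : ℝ) (σ : ℝ → ℂ) (z : ℝ) : ℂ :=
  ∑ i, c i * (ramp (ζ i) z : ℂ) + ∫ y in (0:ℝ)..Z, (ramp y z : ℂ) * σ y

/-- **Its jet at `0`**: `J = Σ_i c_i + ∫₀^Z σ` (`= −V′(0⁺)` when all `ζ_i > 0`). [cite: Zhang2022LandauSiegel, §8 Lemma 8.2] -/
def superposedJet {n : ℕ} (c : Fin n → ℂ) (Z : ℝ) (σ : ℝ → ℂ) : ℂ :=
  ∑ i, c i + ∫ y in (0:ℝ)..Z, σ y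

omit [NeZero D] in
/-- **The exact superposition identity:** for `Λ > 0`, `0 ≤ Z`, atoms with `0 ≤ ζ_i ≤ Z`, `σ` integrable on `[0,Z]`:
`Σ_{m≤e^{ZΛ}} χ(m)m⁻¹V(log m/Λ) = Λ⁻¹·[Σ_i c_i R_χ(e^{ζ_iΛ}) + ∫₀^Z R_χ(e^{yΛ})σ(y)dy]`.
[cite: Zhang2022LandauSiegel, §8 Lemma 8.2] -/
theorem sum_superposed_eq {Λ Z : ℝ} (hΛ : 0 < Λ) (hZ : 0 ≤ Z) {n : ℕ} (c : Fin n → ℂ) (ζ : Fin n → ℝ)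
    (hζ : ∀ i, 0 ≤ ζ i ∧ ζ i ≤ Z) {σ : ℝ → ℂ} (hσ : IntervalIntegrable σ volume 0 Z) :
    ∑ m ∈ Finset.Ioc 0 ⌊Real.exp (Z * Λ)⌋₊,
        χ (m : ZMod D) * (m : ℂ)⁻¹ * superposedWeight c ζ Z σ (Real.log m / Λ)
      = (Λ : ℂ)⁻¹ * (∑ i, c i * rieszMean χ (Real.exp (ζ i * Λ))
          + ∫ y in (0:ℝ)..Z, rieszMean χ (Real.exp (y * Λ)) * σ y) := by
  set N : ℕ := ⌊Real.exp (Z * Λ)⌋₊ with hN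
  have hmono : ∀ {y : ℝ}, y ≤ Z → ⌊Real.exp (y * Λ)⌋₊ ≤ N := fun hy =>
    Nat.floor_le_floor (Real.exp_le_exp.mpr (mul_le_mul_of_nonneg_right hy hΛ.le))
  -- expand the weight and distribute the (finite) `m`-sum
  have hsplit : ∀ m : ℕ, χ (m : ZMod D) * (m : ℂ)⁻¹ * superposedWeight c ζ Z σ (Real.log m / Λ)
      = (∑ i, c i * (χ (m : ZMod D) * (m : ℂ)⁻¹ * (ramp (ζ i) (Real.log m / Λ) : ℂ)))
        + ∫ y in (0:ℝ)..Z, χ (m : ZMod D) * (m : ℂ)⁻¹ * ((ramp y (Real.log m / Λ) : ℂ) * σ y) := by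
    intro m
    unfold superposedWeight
    rw [mul_add, Finset.mul_sum, ← intervalIntegral.integral_const_mul]
    congr 1
    refine Finset.sum_congr rfl fun i _ => ?_
    ring
  simp_rw [hsplit]
  rw [Finset.sum_add_distrib, Finset.sum_comm]
  -- atoms
  have hatoms : ∑ i, ∑ m ∈ Finset.Ioc 0 N, c i * (χ (m : ZMod D) * (m : ℂ)⁻¹ * (ramp (ζ i) (Real.log m / Λ) : ℂ))
      = ∑ i, c i * rieszMean χ (Real.exp (ζ i * Λ)) * (Λ : ℂ)⁻¹ := by
    refine Finset.sum_congr rfl fun i _ => ?_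
    rw [← Finset.mul_sum, sum_ramp_eq_rieszMean χ hΛ (hmono (hζ i).2)]
    ring
  -- density: swap the finite sum and the integral
  have hint : ∀ m ∈ Finset.Ioc 0 N, IntervalIntegrable
      (fun y => χ (m : ZMod D) * (m : ℂ)⁻¹ * ((ramp y (Real.log m / Λ) : ℂ) * σ y)) volume 0 Z := by
    intro m _
    have h1 : IntervalIntegrable (fun y => (ramp y (Real.log m / Λ) : ℂ) * σ y) volume 0 Z :=
      hσ.continuousOn_mul (Complex.continuous_ofReal.comp (continuous_ramp_left _)).continuousOn
    exact h1.const_mul _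
  have hdens : ∑ m ∈ Finset.Ioc 0 N, ∫ y in (0:ℝ)..Z, χ (m : ZMod D) * (m : ℂ)⁻¹ * ((ramp y (Real.log m / Λ) : ℂ) * σ y)
      = ∫ y in (0:ℝ)..Z, rieszMean χ (Real.exp (y * Λ)) * σ y * (Λ : ℂ)⁻¹ := by
    rw [← intervalIntegral.integral_finsetSum hint]
    refine intervalIntegral.integral_congr fun y hy => ?_
    rw [Set.uIcc_of_le hZ] at hy
    have hsum : ∑ m ∈ Finset.Ioc 0 N, χ (m : ZMod D) * (m : ℂ)⁻¹ * ((ramp y (Real.log m / Λ) : ℂ) * σ y)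
        = (∑ m ∈ Finset.Ioc 0 N, χ (m : ZMod D) * (m : ℂ)⁻¹ * (ramp y (Real.log m / Λ) : ℂ)) * σ y := by
      rw [Finset.sum_mul]
      refine Finset.sum_congr rfl fun m _ => ?_
      ring
    simp only [hsum, sum_ramp_eq_rieszMean χ hΛ (hmono hy.2)]
    ring
  rw [hatoms, hdens, ← Finset.sum_mul, intervalIntegral.integral_mul_const]
  ring


omit [NeZero D] in
/-- `y ↦ R_χ(e^{yΛ})` is continuous on `[0,Z]` (it is `Λ·Σ_{m≤e^{ZΛ}} χ(m)m⁻¹(y − log m/Λ)₊` there, a finite sum of ramps)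
— plumbing for the superposition integral of Lemma 8.2. [cite: Zhang2022LandauSiegel, §8 Lemma 8.2] -/
theorem continuousOn_rieszMean_exp {Λ Z : ℝ} (hΛ : 0 < Λ) :
    ContinuousOn (fun y => rieszMean χ (Real.exp (y * Λ))) (Icc 0 Z) := by
  set N : ℕ := ⌊Real.exp (Z * Λ)⌋₊ with hN
  have hΛ0 : (Λ : ℂ) ≠ 0 := by exact_mod_cast hΛ.ne'
  have heq : EqOn (fun y => rieszMean χ (Real.exp (y * Λ)))
      (fun y => (Λ : ℂ) * ∑ m ∈ Finset.Ioc 0 N, χ (m : ZMod D) * (m : ℂ)⁻¹ * (ramp y (Real.log m / Λ) : ℂ))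
      (Icc 0 Z) := by
    intro y hy
    have hmono : ⌊Real.exp (y * Λ)⌋₊ ≤ N :=
      Nat.floor_le_floor (Real.exp_le_exp.mpr (mul_le_mul_of_nonneg_right hy.2 hΛ.le))
    simp only [sum_ramp_eq_rieszMean χ hΛ hmono]
    field_simp
  refine ContinuousOn.congr ?_ heq
  refine (continuousOn_const.mul (continuousOn_finsetSum _ fun m _ => ?_))
  exact (continuousOn_const.mul
    (Complex.continuous_ofReal.comp (continuous_ramp_left _)).continuousOn)

/-! ### The dipole rule for superposed weights -/

/-- for `0 ≤ y`, `0 ≤ Λ`: `1 ≤ e^{yΛ}`. [folklore] -/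
private theorem one_le_exp_mul {y Λ : ℝ} (hy : 0 ≤ y) (hΛ : 0 ≤ Λ) : 1 ≤ Real.exp (y * Λ) :=
  Real.one_le_exp (mul_nonneg hy hΛ)

/-- **THE DIPOLE RULE FOR SUPERPOSED WEIGHTS (fixed modulus, under (A)).** Let `χ` be primitive mod `D`, `𝓛 = log D ≥ 3`,
`‖L(1,χ)‖ ≤ 𝓛⁻²⁰²²`; `Λ = 𝓛⁹` (`= log P`), `τ = 𝓛^{1.1}/𝓛⁹` (`e^{τΛ} = T`). For a superposed weight with atoms at heights
`τ ≤ ζ_i ≤ Z ≤ 1` and a density `σ` integrable on `[0,Z]` with `‖σ‖ ≤ S` on `[0,τ]`: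
`‖Σ_{m≤P^Z} χ(m)m⁻¹V(z_m) − Λ⁻¹·L′(1,χ)·J‖ ≤ Λ⁻¹·[C₈₂(0)𝓛⁻⁶(Σ‖c_i‖ + ∫₀^Z‖σ‖) + τ·S·(2𝓛^{2.2} + ‖L′(1,χ)‖)]`,
`J = Σc_i + ∫σ` — i.e. `Σ_m χ(m)m⁻¹V(z_m) = −L′(1,χ)V′(0⁺)/log P + O(𝓛⁻¹⁵‖V″‖ + S𝓛^{−14.7})`, DISPLAY #2's LEMMA A for
every weight the caller writes as ramps (kinks) + density (curvature). [cite: Zhang2022LandauSiegel, §8 Lemma 8.2] -/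
theorem dipole_superposed (hprim : χ.IsPrimitive) (hL : 3 ≤ Real.log D)
    (hA : ‖χ.LFunction 1‖ ≤ 1 / Real.log D ^ 2022) {n : ℕ} (c : Fin n → ℂ) (ζ : Fin n → ℝ) {Z S : ℝ}
    {σ : ℝ → ℂ} (hZ1 : Z ≤ 1)
    (hζ : ∀ i, Real.log D ^ (11 / 10 : ℝ) / Real.log D ^ 9 ≤ ζ i ∧ ζ i ≤ Z)
    (hτZ : Real.log D ^ (11 / 10 : ℝ) / Real.log D ^ 9 ≤ Z)
    (hσ : IntervalIntegrable σ volume 0 Z)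
    (hS : ∀ y ∈ Icc (0 : ℝ) (Real.log D ^ (11 / 10 : ℝ) / Real.log D ^ 9), ‖σ y‖ ≤ S) :
    ‖(∑ m ∈ Finset.Ioc 0 ⌊Real.exp (Z * Real.log D ^ 9)⌋₊,
        χ (m : ZMod D) * (m : ℂ)⁻¹ * superposedWeight c ζ Z σ (Real.log m / Real.log D ^ 9))
        - ((Real.log D ^ 9 : ℝ) : ℂ)⁻¹ * deriv χ.LFunction 1 * superposedJet c Z σ‖
      ≤ (Real.log D ^ 9)⁻¹ *
        (Lemma82.C82 0 / Real.log D ^ 6 * (∑ i, ‖c i‖ + ∫ y in (0:ℝ)..Z, ‖σ y‖)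
          + Real.log D ^ (11 / 10 : ℝ) / Real.log D ^ 9 * S *
            (2 * Real.log D ^ (22 / 10 : ℝ) + ‖deriv χ.LFunction 1‖)) := by
  -- names
  set ℓ : ℝ := Real.log D with hℓ
  set Λ : ℝ := ℓ ^ 9 with hΛ
  set τ : ℝ := ℓ ^ (11 / 10 : ℝ) / Λ with hτ
  set L1 : ℂ := deriv χ.LFunction 1 with hL1
  set E : ℝ := Lemma82.C82 0 / ℓ ^ 6 with hE
  have hℓ1 : 1 ≤ ℓ := by linarith
  have hℓ0 : 0 < ℓ := by linarith
  have hΛ0 : 0 < Λ := by positivity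
  have hτ0 : 0 < τ := by positivity
  have hZ0 : 0 ≤ Z := hτ0.le.trans hτZ
  have hS0 : 0 ≤ S := (norm_nonneg _).trans (hS 0 ⟨le_rfl, hτ0.le⟩)
  have hE0 : 0 ≤ E := by
    have h' := rieszMean_sub_deriv_le χ hprim hL hA (x := Real.exp (ℓ ^ 9)) ?_ le_rfl
    · exact (norm_nonneg _).trans h'
    · exact Real.exp_le_exp.mpr (by
        calc ℓ ^ (11 / 10 : ℝ) ≤ ℓ ^ (9 : ℝ) := Real.rpow_le_rpow_of_exponent_le hℓ1 (by norm_num)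
          _ = ℓ ^ 9 := by norm_cast)
  -- (R) at a height `y ∈ [τ, 1]`: `‖R(e^{yΛ}) − L′‖ ≤ E`
  have hR : ∀ y : ℝ, τ ≤ y → y ≤ 1 → ‖rieszMean χ (Real.exp (y * Λ)) - L1‖ ≤ E := by
    intro y hy1 hy2
    refine rieszMean_sub_deriv_le χ hprim hL hA ?_ ?_
    · apply Real.exp_le_exp.mpr
      have : τ * Λ = ℓ ^ (11 / 10 : ℝ) := by rw [hτ]; field_simp
      rw [← this]
      exact mul_le_mul_of_nonneg_right hy1 hΛ0.le
    · apply Real.exp_le_exp.mpr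
      calc y * Λ ≤ 1 * Λ := mul_le_mul_of_nonneg_right hy2 hΛ0.le
        _ = ℓ ^ 9 := one_mul _
  -- trivial bound at a height `y ∈ [0, τ]`: `‖R(e^{yΛ}) − L′‖ ≤ 2𝓛^{2.2} + ‖L′‖`
  have hlow : ∀ y : ℝ, 0 ≤ y → y ≤ τ →
      ‖rieszMean χ (Real.exp (y * Λ)) - L1‖ ≤ 2 * ℓ ^ (22 / 10 : ℝ) + ‖L1‖ := by
    intro y hy0 hyτ
    have h1 : 1 ≤ Real.exp (y * Λ) := one_le_exp_mul hy0 hΛ0.le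
    have hlog : Real.log (Real.exp (y * Λ)) = y * Λ := Real.log_exp _
    have hyΛ : y * Λ ≤ ℓ ^ (11 / 10 : ℝ) := by
      calc y * Λ ≤ τ * Λ := mul_le_mul_of_nonneg_right hyτ hΛ0.le
        _ = ℓ ^ (11 / 10 : ℝ) := by rw [hτ]; field_simp
    have hyΛ0 : 0 ≤ y * Λ := mul_nonneg hy0 hΛ0.le
    have h11 : 1 ≤ ℓ ^ (11 / 10 : ℝ) := Real.one_le_rpow hℓ1 (by norm_num)
    have hsq : ℓ ^ (11 / 10 : ℝ) * ℓ ^ (11 / 10 : ℝ) = ℓ ^ (22 / 10 : ℝ) := by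
      rw [← Real.rpow_add hℓ0]; norm_num
    have hRb := norm_rieszMean_le χ h1
    rw [hlog] at hRb
    calc ‖rieszMean χ (Real.exp (y * Λ)) - L1‖ ≤ ‖rieszMean χ (Real.exp (y * Λ))‖ + ‖L1‖ := norm_sub_le _ _
      _ ≤ y * Λ * (1 + y * Λ) + ‖L1‖ := by gcongr
      _ ≤ ℓ ^ (11 / 10 : ℝ) * (1 + ℓ ^ (11 / 10 : ℝ)) + ‖L1‖ := by gcongr
      _ ≤ ℓ ^ (11 / 10 : ℝ) * (ℓ ^ (11 / 10 : ℝ) + ℓ ^ (11 / 10 : ℝ)) + ‖L1‖ := by gcongr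
      _ = 2 * ℓ ^ (22 / 10 : ℝ) + ‖L1‖ := by rw [← hsq]; ring
  -- the exact identity
  have hζ' : ∀ i, 0 ≤ ζ i ∧ ζ i ≤ Z := fun i => ⟨hτ0.le.trans (hζ i).1, (hζ i).2⟩
  rw [sum_superposed_eq χ hΛ0 hZ0 c ζ hζ' hσ]
  -- rewrite the target difference as `Λ⁻¹ · (atom errors + density error)`
  have hLcast : ((Real.log D ^ 9 : ℝ) : ℂ) = (Λ : ℂ) := by rw [hΛ, hℓ]
  rw [hLcast]
  have hkey : (Λ : ℂ)⁻¹ * (∑ i, c i * rieszMean χ (Real.exp (ζ i * Λ))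
        + ∫ y in (0:ℝ)..Z, rieszMean χ (Real.exp (y * Λ)) * σ y)
        - (Λ : ℂ)⁻¹ * L1 * superposedJet c Z σ
      = (Λ : ℂ)⁻¹ * ((∑ i, c i * (rieszMean χ (Real.exp (ζ i * Λ)) - L1))
          + ∫ y in (0:ℝ)..Z, (rieszMean χ (Real.exp (y * Λ)) - L1) * σ y) := by
    unfold superposedJet
    have hi1 : IntervalIntegrable (fun y => rieszMean χ (Real.exp (y * Λ)) * σ y) volume 0 Z := by
      refine hσ.continuousOn_mul ?_
      rw [Set.uIcc_of_le hZ0]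
      exact continuousOn_rieszMean_exp χ hΛ0
    have hi2 : IntervalIntegrable (fun y => L1 * σ y) volume 0 Z := hσ.const_mul _
    have hsub : (∫ y in (0:ℝ)..Z, (rieszMean χ (Real.exp (y * Λ)) - L1) * σ y)
        = (∫ y in (0:ℝ)..Z, rieszMean χ (Real.exp (y * Λ)) * σ y) - L1 * ∫ y in (0:ℝ)..Z, σ y := by
      rw [← intervalIntegral.integral_const_mul, ← intervalIntegral.integral_sub hi1 hi2]
      refine intervalIntegral.integral_congr fun y _ => ?_
      ring
    have hs : ∑ i, c i * (rieszMean χ (Real.exp (ζ i * Λ)) - L1)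
        = (∑ i, c i * rieszMean χ (Real.exp (ζ i * Λ))) - (∑ i, c i) * L1 := by
      simp only [mul_sub, Finset.sum_sub_distrib, Finset.sum_mul]
    rw [hsub, hs]
    ring
  rw [hkey, norm_mul, norm_inv, Complex.norm_real, Real.norm_eq_abs, abs_of_pos hΛ0]
  refine mul_le_mul_of_nonneg_left ?_ (inv_nonneg.mpr hΛ0.le)
  -- atoms
  have hat : ‖∑ i, c i * (rieszMean χ (Real.exp (ζ i * Λ)) - L1)‖ ≤ E * ∑ i, ‖c i‖ := by
    calc ‖∑ i, c i * (rieszMean χ (Real.exp (ζ i * Λ)) - L1)‖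
        ≤ ∑ i, ‖c i * (rieszMean χ (Real.exp (ζ i * Λ)) - L1)‖ := norm_sum_le _ _
      _ ≤ ∑ i, ‖c i‖ * E := by
          refine Finset.sum_le_sum fun i _ => ?_
          rw [norm_mul]
          exact mul_le_mul_of_nonneg_left (hR (ζ i) (hζ i).1 ((hζ i).2.trans hZ1)) (norm_nonneg _)
      _ = E * ∑ i, ‖c i‖ := by rw [← Finset.sum_mul]; ring
  -- density: split `[0,Z]` at `τ`
  have hdens : ‖∫ y in (0:ℝ)..Z, (rieszMean χ (Real.exp (y * Λ)) - L1) * σ y‖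
      ≤ E * (∫ y in (0:ℝ)..Z, ‖σ y‖) + τ * S * (2 * ℓ ^ (22 / 10 : ℝ) + ‖L1‖) := by
    set F : ℝ → ℂ := fun y => (rieszMean χ (Real.exp (y * Λ)) - L1) * σ y with hF
    have hRc : ContinuousOn (fun y => rieszMean χ (Real.exp (y * Λ)) - L1) (Set.uIcc 0 Z) := by
      rw [Set.uIcc_of_le hZ0]
      exact (continuousOn_rieszMean_exp χ hΛ0).sub continuousOn_const
    have hFi : IntervalIntegrable F volume 0 Z := hσ.continuousOn_mul hRc
    have hsub01 : Set.uIcc (0 : ℝ) τ ⊆ Set.uIcc 0 Z := by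
      rw [Set.uIcc_of_le hτ0.le, Set.uIcc_of_le hZ0]; exact Set.Icc_subset_Icc_right hτZ
    have hsubτZ : Set.uIcc τ Z ⊆ Set.uIcc 0 Z := by
      rw [Set.uIcc_of_le hτZ, Set.uIcc_of_le hZ0]; exact Set.Icc_subset_Icc_left hτ0.le
    have hF1 : IntervalIntegrable F volume 0 τ := hFi.mono_set hsub01
    have hF2 : IntervalIntegrable F volume τ Z := hFi.mono_set hsubτZ
    rw [← intervalIntegral.integral_add_adjacent_intervals hF1 hF2]
    -- low part
    have hlowI : ‖∫ y in (0:ℝ)..τ, F y‖ ≤ (2 * ℓ ^ (22 / 10 : ℝ) + ‖L1‖) * S * |τ - 0| := by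
      refine intervalIntegral.norm_integral_le_of_norm_le_const fun y hy => ?_
      rw [Set.uIoc_of_le hτ0.le] at hy
      rw [hF, norm_mul]
      exact mul_le_mul (hlow y hy.1.le hy.2) (hS y ⟨hy.1.le, hy.2⟩) (norm_nonneg _) (by positivity)
    -- high part
    have hσn : IntervalIntegrable (fun y => E * ‖σ y‖) volume τ Z := (hσ.norm.mono_set hsubτZ).const_mul E
    have hhighI : ‖∫ y in τ..Z, F y‖ ≤ ∫ y in τ..Z, E * ‖σ y‖ := by
      refine intervalIntegral.norm_integral_le_of_norm_le hτZ ?_ hσn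
      refine Filter.Eventually.of_forall fun y hy => ?_
      rw [hF, norm_mul]
      exact mul_le_mul_of_nonneg_right (hR y hy.1.le (hy.2.trans hZ1)) (norm_nonneg _)
    have hsplitσ : (∫ y in (0:ℝ)..Z, ‖σ y‖) = (∫ y in (0:ℝ)..τ, ‖σ y‖) + ∫ y in τ..Z, ‖σ y‖ :=
      (intervalIntegral.integral_add_adjacent_intervals (hσ.norm.mono_set hsub01) (hσ.norm.mono_set hsubτZ)).symm
    have hσ0τ : 0 ≤ ∫ y in (0:ℝ)..τ, ‖σ y‖ := intervalIntegral.integral_nonneg hτ0.le fun y _ => norm_nonneg _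
    have hhigh' : (∫ y in τ..Z, E * ‖σ y‖) ≤ E * ∫ y in (0:ℝ)..Z, ‖σ y‖ := by
      rw [intervalIntegral.integral_const_mul, hsplitσ, mul_add]
      have : 0 ≤ E * ∫ y in (0:ℝ)..τ, ‖σ y‖ := mul_nonneg hE0 hσ0τ
      linarith
    calc ‖(∫ y in (0:ℝ)..τ, F y) + ∫ y in τ..Z, F y‖ ≤ ‖∫ y in (0:ℝ)..τ, F y‖ + ‖∫ y in τ..Z, F y‖ := norm_add_le _ _
      _ ≤ (2 * ℓ ^ (22 / 10 : ℝ) + ‖L1‖) * S * |τ - 0| + E * ∫ y in (0:ℝ)..Z, ‖σ y‖ :=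
          add_le_add hlowI (hhighI.trans hhigh')
      _ = E * (∫ y in (0:ℝ)..Z, ‖σ y‖) + τ * S * (2 * ℓ ^ (22 / 10 : ℝ) + ‖L1‖) := by
          rw [sub_zero, abs_of_pos hτ0]; ring
  calc ‖(∑ i, c i * (rieszMean χ (Real.exp (ζ i * Λ)) - L1))
          + ∫ y in (0:ℝ)..Z, (rieszMean χ (Real.exp (y * Λ)) - L1) * σ y‖
      ≤ ‖∑ i, c i * (rieszMean χ (Real.exp (ζ i * Λ)) - L1)‖
          + ‖∫ y in (0:ℝ)..Z, (rieszMean χ (Real.exp (y * Λ)) - L1) * σ y‖ := norm_add_le _ _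
    _ ≤ E * ∑ i, ‖c i‖ + (E * (∫ y in (0:ℝ)..Z, ‖σ y‖) + τ * S * (2 * ℓ ^ (22 / 10 : ℝ) + ‖L1‖)) :=
        add_le_add hat hdens
    _ = E * (∑ i, ‖c i‖ + ∫ y in (0:ℝ)..Z, ‖σ y‖) + τ * S * (2 * ℓ ^ (22 / 10 : ℝ) + ‖L1‖) := by ring

end Literature.NumberTheory.LFunctions.Zhang2022.DipoleRule

end
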